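import Summits.AtomisticToContinuum.BoseEinsteinCondensation.Theorems.BECPeriodicReductionBoundaryTransferWeakResidual

/-!
# Birth skeleton (BC3) of piece X₂ `ModeFreeSlopeToBEC` of the mode-free reward split of
# `BoundaryTransferWeak` (stmt-AtomisticToContinuum-0827)

Two registered stubs and the kernel-checked composition `ModeFreeSlopeToBEC_of`:

* `stub_condensedMinimisersOfChord` (fixed `N, L`; provable now, size M, pure `ℝ≥0∞` variational
  extraction): if `E₀ < ∞` and `G(λ) ≤ E₀ + λ(1 − c)N` for all `0 < λ ≤ λ₁`, then for every slack `η > 0`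
  and every `ε > 0` some Dirichlet trial state lies within `η` of `E₀` and has `λ_max ≥ (c − ε)N`
  (take a `λεN/2`-near-minimiser of the `λ`-rewarded mode-free functional with `λ ≤ min(λ₁, η/(2N))`).
* `stub_modeFreeRigidityTransfer` (open, size M; rigidity of Dirichlet near-minimisers up to phase =
  stmt-9072 `GroundStateRigidity`, plus the phase-blind `√N`-Lipschitz seminorm `√λ_max` — a sup of the
  seminorms `√occ_φ` of `Theorems/…NearMinimiserTransfer.lean` / `CondensateOccupationStability.lean`):
  condensed competitors at EVERY slack with constant `c'` force `condensateNumber ≥ c'' N` for every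
  `c'' < c'`, eventually in `N`, below some density.

`sorry` occurs only inside the two `stub_*`.
-/

noncomputable section

open MeasureTheory Filter
open scoped ENNReal NNReal Topology

namespace Summit.AtomisticToContinuum.BoseEinsteinCondensation.ModeFreeReward.BirthX2

open Literature.MathematicalPhysics.QuantumManyBody.BoseGas

/-- **Stub 1 — condensed minimising sequences from the chord bound** (fixed `N`, `L`). [folklore] -/
theorem stub_condensedMinimisersOfChord :
    ∀ (v : ℝ → ℝ≥0∞) (N : ℕ) (L : ℝ) (c lam₁ : ℝ), 0 < lam₁ → 0 < c →
      groundStateEnergy v N L ≠ ⊤ →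
      (∀ lam : ℝ, 0 < lam → lam ≤ lam₁ →
        (⨅ Ψ : TrialState N L, energy v Ψ + ENNReal.ofReal lam * ((N : ℝ≥0∞) - maxOccupation N Ψ.ψ)) ≤
          groundStateEnergy v N L + ENNReal.ofReal (lam * (1 - c) * N)) →
      ∀ η : ℝ≥0∞, 0 < η → ∀ ε : ℝ, 0 < ε → ∃ Ψ : TrialState N L,
        energy v Ψ ≤ groundStateEnergy v N L + η ∧
          ENNReal.ofReal ((c - ε) * N) ≤ maxOccupation N Ψ.ψ := by
  sorry

/-- **Stub 2 — mode-free rigidity transfer** (condensed competitors at every slack ⟹ every near-minimiser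
condensed ⟹ `condensateNumber`; stmt-9072 + `√λ_max` Lipschitz). [folklore] -/
theorem stub_modeFreeRigidityTransfer :
    ∀ v : ℝ → ℝ≥0∞, IsRepulsiveFiniteRange v → ∃ ρ₁ : ℝ, 0 < ρ₁ ∧ ∀ ρ : ℝ, 0 < ρ → ρ < ρ₁ →
      ∀ c' c'' : ℝ, 0 < c'' → c'' < c' → ∀ᶠ N : ℕ in atTop,
        groundStateEnergy v N (sideLength ρ N) ≠ ⊤ →
        (∀ η : ℝ≥0∞, 0 < η → ∃ Ψ : TrialState N (sideLength ρ N),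
          energy v Ψ ≤ groundStateEnergy v N (sideLength ρ N) + η ∧
            ENNReal.ofReal (c' * N) ≤ maxOccupation N Ψ.ψ) →
        ENNReal.ofReal (c'' * N) ≤ condensateNumber v N (sideLength ρ N) := by
  sorry

/-- **Composition** — piece X₂ `ModeFreeSlopeToBEC` (verbatim the filed statement) from the two stubs:
at `N`, stub 1 with `ε = c/4` gives condensed competitors at every slack with constant `c − c/4`, and
stub 2 with `c'' = c/2 < c − c/4` gives `condensateNumber ≥ (c/2) N`. [folklore] -/
theorem ModeFreeSlopeToBEC_of
    (h₁ : ∀ (v : ℝ → ℝ≥0∞) (N : ℕ) (L : ℝ) (c lam₁ : ℝ), 0 < lam₁ → 0 < c →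
      groundStateEnergy v N L ≠ ⊤ →
      (∀ lam : ℝ, 0 < lam → lam ≤ lam₁ →
        (⨅ Ψ : TrialState N L, energy v Ψ + ENNReal.ofReal lam * ((N : ℝ≥0∞) - maxOccupation N Ψ.ψ)) ≤
          groundStateEnergy v N L + ENNReal.ofReal (lam * (1 - c) * N)) →
      ∀ η : ℝ≥0∞, 0 < η → ∀ ε : ℝ, 0 < ε → ∃ Ψ : TrialState N L,
        energy v Ψ ≤ groundStateEnergy v N L + η ∧
          ENNReal.ofReal ((c - ε) * N) ≤ maxOccupation N Ψ.ψ)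
    (h₂ : ∀ v : ℝ → ℝ≥0∞, IsRepulsiveFiniteRange v → ∃ ρ₁ : ℝ, 0 < ρ₁ ∧ ∀ ρ : ℝ, 0 < ρ → ρ < ρ₁ →
      ∀ c' c'' : ℝ, 0 < c'' → c'' < c' → ∀ᶠ N : ℕ in atTop,
        groundStateEnergy v N (sideLength ρ N) ≠ ⊤ →
        (∀ η : ℝ≥0∞, 0 < η → ∃ Ψ : TrialState N (sideLength ρ N),
          energy v Ψ ≤ groundStateEnergy v N (sideLength ρ N) + η ∧
            ENNReal.ofReal (c' * N) ≤ maxOccupation N Ψ.ψ) →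
        ENNReal.ofReal (c'' * N) ≤ condensateNumber v N (sideLength ρ N)) :
    ∀ v : ℝ → ENNReal, Literature.MathematicalPhysics.QuantumManyBody.BoseGas.IsRepulsiveFiniteRange v → ∃ ρ₁ : ℝ, 0 < ρ₁ ∧ ∀ ρ : ℝ, 0 < ρ → ρ < ρ₁ → ∀ c : ℝ, 0 < c → c ≤ 1 → ∀ᶠ N : ℕ in Filter.atTop, Literature.MathematicalPhysics.QuantumManyBody.BoseGas.groundStateEnergy v N (Literature.MathematicalPhysics.QuantumManyBody.BoseGas.sideLength ρ N) ≠ ⊤ → (∃ lam₁ : ℝ, 0 < lam₁ ∧ ∀ lam : ℝ, 0 < lam → lam ≤ lam₁ → (⨅ Ψ : Literature.MathematicalPhysics.QuantumManyBody.BoseGas.TrialState N (Literature.MathematicalPhysics.QuantumManyBody.BoseGas.sideLength ρ N), Literature.MathematicalPhysics.QuantumManyBody.BoseGas.energy v Ψ + ENNReal.ofReal lam * ((N : ENNReal) - Literature.MathematicalPhysics.QuantumManyBody.BoseGas.maxOccupation N Ψ.ψ)) ≤ Literature.MathematicalPhysics.QuantumManyBody.BoseGas.groundStateEnergy v N (Literature.MathematicalPhysics.QuantumManyBody.BoseGas.sideLength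 ρ N) + ENNReal.ofReal (lam * (1 - c) * N)) → ENNReal.ofReal (c / 2 * N) ≤ Literature.MathematicalPhysics.QuantumManyBody.BoseGas.condensateNumber v N (Literature.MathematicalPhysics.QuantumManyBody.BoseGas.sideLength ρ N) := by
  intro v hv
  obtain ⟨ρ₁, hρ₁, H⟩ := h₂ v hv
  refine ⟨ρ₁, hρ₁, fun ρ hρ hlt c hc _hc1 => ?_⟩
  have hlt' : c / 2 < c - c / 4 := by linarith
  filter_upwards [H ρ hρ hlt (c - c / 4) (c / 2) (by positivity) hlt'] with N hN hE0 hchord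
  obtain ⟨lam₁, hlam₁, hG⟩ := hchord
  exact hN hE0 fun η hη =>
    h₁ v N (sideLength ρ N) c lam₁ hlam₁ hc hE0 hG η hη (c / 4) (by positivity)

end Summit.AtomisticToContinuum.BoseEinsteinCondensation.ModeFreeReward.BirthX2

end
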